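import Literature.NumberTheory.LFunctions.ConreyIwaniec2002LPointwise
import Mathlib.Analysis.SpecialFunctions.Log.Monotone
import HarnessLib

/-!
# Conrey–Iwaniec (2002), Proposition 9.1 for ARBITRARY companions

B. Conrey, H. Iwaniec, *Spacing of zeros of Hecke L-functions and the class number problem*,
Acta Arith. 103 (2002), §§7–9 [held text `paper:arxiv-math_0111012`, p0017–p0020]: Proposition 9.1
(9.7) is stated for `1`-spaced `s = ½ + it`, `T < t ≤ 2T`, and "to each point `s_r` we associate a
point `s′_r = ½ + it′_r`" (8.4) — NO condition on the companion. The tree holds (9.7) for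
companions `|t′ − t| ≤ T/4` (`prop91_far_of_proposition64`, from Proposition 6.4). THIS FILE removes
the last restriction: for a REMOTE companion (`|t′ − t| > T/4`) the summand
`|ℓ(s)M̄(s) − x(s)| ≤ (|L(s)| + |L(s′)|)|M(s)|/|t − t′| + 2/|t − t′|` only needs a POINTWISE bound
`|L(½+iu,ψ)|² ≪ (T(log q)^7 + Tℒ(T)(log T)^4)·|u − t|²/T²` (`norm_sq_le_remote`), supplied by the
three regimes of `ConreyIwaniec2002LPointwise`:
* `|u| ≥ T/q²`: the one-point mean square (`norm_sq_le_of_large`) — for `|u| > 4T` with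
  `(log v)⁵/v` decreasing (`log_pow_five_div_le`, Mathlib's `Real.log_div_self_rpow_antitoneOn`);
* `q + 5 ≤ |u| < T/q²`: the approximate functional equation with Cauchy (`norm_afeA_sq_le_conv`),
  where `Q|s| + 2 ≤ T/(3q)` makes every logarithm `≤ log T` and `T(log T)⁵/q ≤ Tℒ(T)(log T)⁴`
  by the class number formula `L(1,χ)²q ≥ 1`;
* `|u| < q + 5`: the uniform convexity bound (`norm_le_crude`).
RESULT (PROVED, modulo the typed Proposition 6.4 = binder `h64` only):
`prop91_of_proposition64` — (9.7) VERBATIM for `1`-spaced `S ⊂ (T, 2T]` and an ARBITRARY companion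
map `t′ : ℝ → ℝ`, in the range `2q^68 ≤ T`, `2q²e^{(log q)²} ≤ T` (the factor `q²` over the range of
`prop91_far_of_proposition64` puts the height `T/q²` inside the range of the mean squares). This is
input I6b (the I6 skeleton's binder `stub_prop91_large`: `q^65 ≤ T`, `e^{(log q)²} ≤ T`, `t′`
arbitrary) up to the range constants `65 ↦ 68` and `1 ↦ 2q²`. No definition, no named fact.

«The programme SEARCHES and TYPES; no claim about Landau–Siegel zeros, Theorems 1–2 of
arXiv:2211.02515 or a repaired Margin232 until a kernel theorem says so.»

## References
* [ConreyIwaniec2002] B. Conrey, H. Iwaniec, Acta Arith. 103 (2002) 259–312, arXiv:math/0111012: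
  Proposition 7.1 (7.12), (7.19)–(7.20), §8 (8.1)–(8.4), (8.10), Proposition 9.1 (9.6)–(9.7).
-/

noncomputable section

open scoped NumberField ComplexConjugate
open Complex

namespace Literature.NumberTheory.LFunctions

namespace ConreyIwaniec2002

open NumberField

/-! ### §1. `(log v)⁵/v` decreases beyond `e⁵` -/

/-- `(log y)^5/y ≤ (log x)^5/x` for `e^5 ≤ x ≤ y` (Mathlib's `log x / x^a` antitone, `a = 1/5`);
private plumbing. [folklore] -/
private theorem log_pow_five_div_le {x y : ℝ} (hx : Real.exp 5 ≤ x) (hxy : x ≤ y) :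
    Real.log y ^ 5 / y ≤ Real.log x ^ 5 / x := by
  have hx0 : 0 < x := lt_of_lt_of_le (Real.exp_pos 5) hx
  have hy0 : 0 < y := by linarith
  have ha : (0 : ℝ) < 1 / 5 := by norm_num
  have hanti := Real.log_div_self_rpow_antitoneOn ha
  have hx' : x ∈ Set.Ici (Real.exp (1 / 5 : ℝ)⁻¹) := by
    rw [Set.mem_Ici]; norm_num; exact hx
  have hy' : y ∈ Set.Ici (Real.exp (1 / 5 : ℝ)⁻¹) := by
    rw [Set.mem_Ici]; norm_num; exact hx.trans hxy
  have h := hanti hx' hy' hxy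
  simp only at h
  -- `(log z / z^{1/5})^5 = (log z)^5 / z`
  have hid : ∀ z : ℝ, 0 < z → (Real.log z / z ^ (1 / 5 : ℝ)) ^ 5 = Real.log z ^ 5 / z := by
    intro z hz
    rw [div_pow, ← Real.rpow_natCast (z ^ (1 / 5 : ℝ)) 5, ← Real.rpow_mul hz.le]
    norm_num
  have hx1 : 1 ≤ x := le_trans (by have := Real.add_one_le_exp (5 : ℝ); linarith) hx
  have hfy0 : 0 ≤ Real.log y / y ^ (1 / 5 : ℝ) :=
    div_nonneg (Real.log_nonneg (by linarith)) (Real.rpow_nonneg hy0.le _)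
  rw [← hid x hx0, ← hid y hy0]
  exact pow_le_pow_left₀ hfy0 h 5

/-! ### §2. A remote companion: the pointwise bound in all three regimes -/

/-- Numerical constants: `e⁴ < 55`, `e⁵ < 149`; private plumbing. [folklore] -/
private theorem exp_four_lt : Real.exp 4 < 55 ∧ Real.exp 5 < 149 := by
  have h1 := Real.exp_one_lt_d9
  have h0 : 0 < Real.exp 1 := Real.exp_pos 1
  have e4 : Real.exp 4 = Real.exp 1 ^ 4 := by rw [Real.exp_one_pow]; norm_num
  have e5 : Real.exp 5 = Real.exp 1 ^ 5 := by rw [Real.exp_one_pow]; norm_num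
  constructor
  · rw [e4]
    calc Real.exp 1 ^ 4 < (2.7182818286 : ℝ) ^ 4 := pow_lt_pow_left₀ h1 h0.le (by norm_num)
      _ < 55 := by norm_num
  · rw [e5]
    calc Real.exp 1 ^ 5 < (2.7182818286 : ℝ) ^ 5 := pow_lt_pow_left₀ h1 h0.le (by norm_num)
      _ < 149 := by norm_num

/-- `(2a + M)² ≤ 8a² + 2M²`; private plumbing. [folklore] -/
private theorem sq_two_mul_add_le (a M : ℝ) : (2 * a + M) ^ 2 ≤ 8 * a ^ 2 + 2 * M ^ 2 := by
  nlinarith [sq_nonneg (2 * a - M)]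

/-- `Q = √q/2π ≤ q/12` for `q ≥ 4`; private plumbing. [folklore] -/
private theorem condQ_le_div_twelve {q : ℕ} (hq : (4 : ℝ) ≤ q) : condQ q ≤ q / 12 := by
  unfold condQ
  have hpi : (6 : ℝ) ≤ 2 * Real.pi := by linarith [Real.pi_gt_three]
  have hsq : Real.sqrt q ≤ q / 2 := by
    rw [Real.sqrt_le_left (by positivity)]
    nlinarith
  calc Real.sqrt q / (2 * Real.pi) ≤ Real.sqrt q / 6 :=
      div_le_div_of_nonneg_left (Real.sqrt_nonneg _) (by norm_num) hpi
    _ ≤ (q / 2) / 6 := by gcongr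
    _ = q / 12 := by ring

/-- `(q/12)(T/q² + 1) + 2 ≤ T/(3q)` for `q ≥ 5`, `T ≥ 2q^68`; private plumbing. [folklore] -/
private theorem height_le_div {q T : ℝ} (hq : 5 ≤ q) (hT : 2 * q ^ (68 : ℕ) ≤ T) :
    q / 12 * (T / q ^ (2 : ℕ) + 1) + 2 ≤ T / (3 * q) := by
  have hq0 : 0 < q := by linarith
  have hq1 : 1 ≤ q := by linarith
  have h2 : q / 12 * (T / q ^ (2 : ℕ) + 1) = T / (12 * q) + q / 12 := by
    field_simp
  have hq3 : q ^ (3 : ℕ) ≤ q ^ (68 : ℕ) := pow_le_pow_right₀ hq1 (by norm_num)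
  have h3 : q / 12 + 2 ≤ T / (4 * q) := by
    rw [le_div_iff₀ (by positivity)]
    have hA : q / 12 + 2 ≤ q := by linarith
    have hq4 : 0 ≤ q - 4 := by linarith
    calc (q / 12 + 2) * (4 * q) ≤ q * (4 * q) := mul_le_mul_of_nonneg_right hA (by positivity)
      _ = 4 * q ^ (2 : ℕ) := by ring
      _ ≤ q ^ (3 : ℕ) := by nlinarith [mul_nonneg (sq_nonneg q) hq4]
      _ ≤ q ^ (68 : ℕ) := hq3
      _ ≤ T := by nlinarith [pow_nonneg hq0.le 68]
  have h4 : T / (12 * q) + T / (4 * q) = T / (3 * q) := by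
    field_simp
    ring
  linarith

/-- `ℒ(v)·log T ≤ ℒ(T)·log v` for `1 ≤ T ≤ v` (`ℒ(Y) = L₁(L₁ log Y + L₁′)`); private plumbing.
[folklore] -/
private theorem calL_mul_log_le {q : ℕ} [NeZero q] (χ : DirichletCharacter ℂ q) {T v : ℝ}
    (hT : 0 < T) (hTv : T ≤ v) : calL χ v * Real.log T ≤ calL χ T * Real.log v := by
  unfold calL
  have hL1 : 0 ≤ ‖χ.LFunction 1‖ := norm_nonneg _
  have hd : 0 ≤ ‖deriv χ.LFunction 1‖ := norm_nonneg _
  have hlog : Real.log T ≤ Real.log v := Real.log_le_log hT hTv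
  nlinarith [mul_nonneg (mul_nonneg hL1 hd) (sub_nonneg.2 hlog)]

set_option maxHeartbeats 400000 in
/-- **THE POINTWISE BOUND AT A REMOTE COMPANION.** For `q` odd `> 4`, `K = ℚ(√−q)`, `ψ ∈ Ĉℓ(K)`,
`2q^68 ≤ T`, `2q²e^{(log q)²} ≤ T`, `T < t ≤ 2T` and ANY real `u` with `|u − t| > T/4`:
`|L(½+iu,ψ)|² ≤ C·(T(log q)^7 + Tℒ(T)(log T)^4)·|u − t|²/T²` — by the one-point mean square
(`|u| ≥ T/q²`, with `ℒ(v)(log v)⁴/v` decreasing beyond `4T`), the approximate functional equation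
with Cauchy (`q + 5 ≤ |u| < T/q²`, where `Q|s| + 2 ≤ T/(3q)`), and the uniform convexity bound
(`|u| < q + 5`). [cite: ConreyIwaniec2002, Proposition 7.1 (7.12); §8 (8.10)] -/
theorem norm_sq_le_remote (h64 : conreyIwaniec2002_proposition64) :
    ∃ C : ℝ, 0 < C ∧
    ∀ (q : ℕ) [NeZero q], 4 < q → Odd q → ∀ χ : DirichletCharacter ℂ q,
      χ.IsPrimitive → χ.IsQuadratic → χ.Odd →
        ∀ (K : Type) [Field K] [NumberField K],
          Module.finrank ℚ K = 2 → NumberField.discr K = -(q : ℤ) →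
            ∀ (ψ : ClassGroup (𝓞 K) →* ℂˣ) (T t u : ℝ),
              2 * (q : ℝ) ^ (68 : ℕ) ≤ T → 2 * (q : ℝ) ^ (2 : ℕ) * Real.exp (Real.log q ^ (2 : ℕ)) ≤ T →
                T < t → t ≤ 2 * T → T / 4 < |u - t| →
                ‖classGroupLFunction K ψ (1 / 2 + u * I)‖ ^ 2 ≤
                  C * (T * Real.log q ^ (7 : ℕ) + T * calL χ T * Real.log T ^ (4 : ℕ)) *
                    ((u - t) ^ 2 / T ^ 2) := by
  obtain ⟨Cp, hCp, hpt⟩ := norm_sq_le_of_large h64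
  obtain ⟨CA, hCA, hA⟩ := norm_afeA_sq_le_conv
  obtain ⟨M, hM, hR⟩ := norm_afeR_half_le
  obtain ⟨he4, he5⟩ := exp_four_lt
  refine ⟨1041 * Cp + 256 * CA + 32 * M ^ 2 + 16, by positivity,
    fun q _ hq hodd χ hprim hquad hoddχ K _ _ h2 hdisc ψ T t u hT hexpT hTt ht2 hut => ?_⟩
  -- numerics
  have hq0 : 0 < q := by omega
  have hq5 : (5 : ℝ) ≤ q := by exact_mod_cast hq
  have hq1 : (1 : ℝ) ≤ q := by linarith
  have hqpos : (0 : ℝ) < q := by linarith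
  have hexp0 := Real.exp_pos (Real.log q ^ (2 : ℕ))
  have hq6668 : (q : ℝ) ^ (66 : ℕ) ≤ (q : ℝ) ^ (68 : ℕ) := pow_le_pow_right₀ hq1 (by norm_num)
  have hq68 : 0 ≤ (q : ℝ) ^ (68 : ℕ) := by positivity
  have hq66 : (q : ℝ) ^ (66 : ℕ) ≤ T := by linarith
  have hq2one : (1 : ℝ) ≤ (q : ℝ) ^ (2 : ℕ) := one_le_pow₀ hq1
  have hexp1 : Real.exp (Real.log q ^ (2 : ℕ)) ≤ T := by
    have : Real.exp (Real.log q ^ (2 : ℕ)) ≤ (q : ℝ) ^ (2 : ℕ) * Real.exp (Real.log q ^ (2 : ℕ)) :=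
      le_mul_of_one_le_left hexp0.le hq2one
    linarith
  obtain ⟨hℓ1, hℓLT, hLT1, -, hq41, -, hT3, -⟩ := prop81_numerics hq hq66 hexp1
  have hT0 : 0 < T := by linarith
  have hTne : T ≠ 0 := hT0.ne'
  have hq_le_T : (q : ℝ) ≤ T := by
    have : (q : ℝ) ≤ (q : ℝ) ^ (66 : ℕ) := le_self_pow₀ hq1 (by norm_num)
    linarith
  have h625 : (5 : ℝ) ^ (4 : ℕ) ≤ (q : ℝ) ^ (4 : ℕ) := pow_le_pow_left₀ (by norm_num) hq5 4
  have hq4cast : ((q ^ 4 : ℕ) : ℝ) = (q : ℝ) ^ (4 : ℕ) := by push_cast; ring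
  have hT4 : (626 : ℝ) ≤ T := by norm_num at h625; linarith
  set ℓ : ℝ := Real.log q with hℓ
  set LT : ℝ := Real.log T with hLT
  set cLT : ℝ := calL χ T with hcLT
  have hℓ0 : 0 ≤ ℓ := by linarith
  have hLT0 : 0 < LT := by linarith
  have hcLT0 : 0 ≤ cLT := calL_nonneg χ (by linarith)
  set X : ℝ := T * ℓ ^ (7 : ℕ) + T * cLT * LT ^ (4 : ℕ) with hX
  have hX0 : 0 ≤ X := by positivity
  have hTX : T ≤ X := by
    have h7 : (1 : ℝ) ≤ ℓ ^ (7 : ℕ) := one_le_pow₀ hℓ1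
    have h8 : T ≤ T * ℓ ^ (7 : ℕ) := le_mul_of_one_le_right hT0.le h7
    have : 0 ≤ T * cLT * LT ^ (4 : ℕ) := by positivity
    rw [hX]; linarith
  have hX1 : 1 ≤ X := by linarith
  -- `T LT⁵/q ≤ X` (class number formula `L(1,χ)²q ≥ 1` and `L(1,χ)² log T ≤ ℒ(T)`)
  obtain ⟨hL1q, hL1LT, -, -⟩ :=
    calL_numerics hq χ hq_le_T (norm_LFunction_one_ge q hq χ hprim hquad hoddχ K h2 hdisc)
  have hLT5 : T * LT ^ (5 : ℕ) / q ≤ X := by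
    rw [div_le_iff₀ hqpos, hX]
    have h1 : LT ≤ ‖χ.LFunction 1‖ ^ 2 * q * LT :=
      le_mul_of_one_le_left hLT0.le hL1q
    have h2 : 0 ≤ T * LT ^ (4 : ℕ) := by positivity
    have h3 : 0 ≤ T * ℓ ^ (7 : ℕ) * q := by positivity
    calc T * LT ^ (5 : ℕ) = T * LT ^ (4 : ℕ) * LT := by ring
      _ ≤ T * LT ^ (4 : ℕ) * (‖χ.LFunction 1‖ ^ 2 * q * LT) := mul_le_mul_of_nonneg_left h1 h2
      _ = T * (‖χ.LFunction 1‖ ^ 2 * LT) * LT ^ (4 : ℕ) * q := by ring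
      _ ≤ T * cLT * LT ^ (4 : ℕ) * q := by gcongr
      _ ≤ (T * ℓ ^ (7 : ℕ) + T * cLT * LT ^ (4 : ℕ)) * q := by linarith
  -- the factor `|u − t|²/T²`
  set r : ℝ := (u - t) ^ 2 / T ^ 2 with hr
  have hr0 : 0 ≤ r := by positivity
  have hr16 : 1 ≤ 16 * r := by
    have h1 : (T / 4) ^ 2 < |u - t| ^ 2 := pow_lt_pow_left₀ hut (by positivity) two_ne_zero
    rw [sq_abs] at h1
    rw [hr, ← mul_div_assoc, le_div_iff₀ (by positivity)]
    linarith
  have hXr0 : 0 ≤ X * r := by positivity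
  -- every case proves `‖L‖² ≤ c·X·r` with `c ≤` the constant
  have hfinal : ∀ c : ℝ, c ≤ 1041 * Cp + 256 * CA + 32 * M ^ 2 + 16 →
      ‖classGroupLFunction K ψ (1 / 2 + u * I)‖ ^ 2 ≤ c * X * r →
      ‖classGroupLFunction K ψ (1 / 2 + u * I)‖ ^ 2 ≤
        (1041 * Cp + 256 * CA + 32 * M ^ 2 + 16) * X * r := by
    intro c hc h
    refine h.trans ?_
    rw [mul_assoc, mul_assoc]
    exact mul_le_mul_of_nonneg_right hc hXr0
  have ht0 : 0 < t := by linarith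
  by_cases hlarge : T / (q : ℝ) ^ (2 : ℕ) ≤ |u|
  · -- the one-point mean square at the height `|u|`
    have hTq : (q : ℝ) ^ (66 : ℕ) ≤ T / (q : ℝ) ^ (2 : ℕ) / 2 := by
      rw [le_div_iff₀ (by norm_num : (0 : ℝ) < 2), le_div_iff₀ (by positivity)]
      calc (q : ℝ) ^ (66 : ℕ) * 2 * (q : ℝ) ^ (2 : ℕ) = 2 * (q : ℝ) ^ (68 : ℕ) := by ring
        _ ≤ T := hT
    have hexpq : Real.exp (Real.log q ^ (2 : ℕ)) ≤ T / (q : ℝ) ^ (2 : ℕ) / 2 := by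
      rw [le_div_iff₀ (by norm_num : (0 : ℝ) < 2), le_div_iff₀ (by positivity)]
      linarith
    have hu2 : (q : ℝ) ^ (66 : ℕ) ≤ |u| / 2 := hTq.trans (by linarith)
    have hexpu : Real.exp (Real.log q ^ (2 : ℕ)) ≤ |u| / 2 := hexpq.trans (by linarith)
    have hLu := hpt q hq hodd χ hprim hquad hoddχ K h2 hdisc ψ u hu2 hexpu
    set v : ℝ := |u| / 2 with hv
    have hv1 : 1 ≤ v := le_trans (one_le_pow₀ hq1) hu2
    have hv0 : 0 < v := by linarith
    have hcalv0 : 0 ≤ calL χ v := calL_nonneg χ hv1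
    have hlv0 : 0 ≤ Real.log v := Real.log_nonneg hv1
    by_cases h4T : |u| ≤ 4 * T
    · -- `v ≤ 2T`: `X(v) ≤ 64 X`
      have hv2T : v ≤ 2 * T := by rw [hv]; linarith
      have hT2 : (2 : ℝ) ≤ T := by linarith
      have hc1 : calL χ v ≤ 2 * cLT :=
        (calL_mono χ hv0 hv2T).trans (calL_two_mul_le χ hT2)
      have hl2 : Real.log 2 ≤ LT := Real.log_le_log (by norm_num) hT2
      have hlv : Real.log v ≤ 2 * LT := by
        calc Real.log v ≤ Real.log (2 * T) := Real.log_le_log hv0 hv2T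
          _ = Real.log 2 + LT := by rw [hLT, Real.log_mul (by norm_num) hTne]
          _ ≤ 2 * LT := by linarith
      have hlv4 : Real.log v ^ (4 : ℕ) ≤ (2 * LT) ^ (4 : ℕ) := pow_le_pow_left₀ hlv0 hlv 4
      have hXv : v * ℓ ^ (7 : ℕ) + v * calL χ v * Real.log v ^ (4 : ℕ) ≤ 64 * X := by
        have hvc : v * calL χ v ≤ (2 * T) * (2 * cLT) := mul_le_mul hv2T hc1 hcalv0 (by positivity)
        have h1 : v * calL χ v * Real.log v ^ (4 : ℕ) ≤ (2 * T) * (2 * cLT) * (2 * LT) ^ (4 : ℕ) :=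
          mul_le_mul hvc hlv4 (by positivity) (by positivity)
        have h1' : v * calL χ v * Real.log v ^ (4 : ℕ) ≤ 64 * (T * cLT * LT ^ (4 : ℕ)) :=
          h1.trans (le_of_eq (by ring))
        have hℓ7 : 0 ≤ ℓ ^ (7 : ℕ) := by positivity
        have h2 : v * ℓ ^ (7 : ℕ) ≤ 2 * T * ℓ ^ (7 : ℕ) := mul_le_mul_of_nonneg_right hv2T hℓ7
        have h3 : 0 ≤ T * ℓ ^ (7 : ℕ) := by positivity
        rw [hX]
        linarith
      refine hfinal (1024 * Cp) (by linarith [sq_nonneg M, hCA.le]) ?_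
      calc ‖classGroupLFunction K ψ (1 / 2 + u * I)‖ ^ 2
          ≤ Cp * (v * ℓ ^ (7 : ℕ) + v * calL χ v * Real.log v ^ (4 : ℕ)) := hLu
        _ ≤ Cp * (64 * X) := mul_le_mul_of_nonneg_left hXv hCp.le
        _ = 64 * Cp * X * 1 := by ring
        _ ≤ 64 * Cp * X * (16 * r) := mul_le_mul_of_nonneg_left hr16 (by positivity)
        _ = 1024 * Cp * X * r := by ring
    · -- `v > 2T`: `X(v) ≤ 16 X v²/T²` and `v ≤ |u − t|`
      push Not at h4T
      have hv2T : 2 * T ≤ v := by rw [hv]; linarith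
      have hvT : T ≤ v := by linarith
      have hvut : v ≤ |u - t| := by
        have := abs_sub_abs_le_abs_sub u t
        rw [abs_of_pos ht0] at this
        rw [hv]; linarith
      have hv2r : v ^ 2 / T ^ 2 ≤ r := by
        rw [hr]
        exact div_le_div_of_nonneg_right ((pow_le_pow_left₀ hv0.le hvut 2).trans (le_of_eq (sq_abs _)))
          (by positivity)
      -- `ℒ(v) LT ≤ ℒ(T) log v`
      have hcal : calL χ v * LT ≤ cLT * Real.log v := calL_mul_log_le χ hT0 hvT
      -- `(log v)^5 T ≤ 16 v LT^5`
      have he5T : Real.exp 5 ≤ 2 * T := by linarith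
      have hmono := log_pow_five_div_le he5T hv2T
      have hl2T : Real.log (2 * T) ≤ 2 * LT := by
        rw [hLT, Real.log_mul (by norm_num) hTne]
        have : Real.log 2 ≤ Real.log T := Real.log_le_log (by norm_num) (by linarith)
        linarith
      have hl2T0 : 0 ≤ Real.log (2 * T) := Real.log_nonneg (by linarith)
      have hl2T5 : Real.log (2 * T) ^ 5 ≤ (2 * LT) ^ 5 := pow_le_pow_left₀ hl2T0 hl2T 5
      have hlv5 : Real.log v ^ 5 * T ≤ 16 * v * LT ^ 5 := by
        have h1 : Real.log v ^ 5 ≤ Real.log (2 * T) ^ 5 / (2 * T) * v := by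
          have := hmono
          rwa [div_le_iff₀ hv0] at this
        have h2 : Real.log (2 * T) ^ 5 / (2 * T) * v ≤ (2 * LT) ^ 5 / (2 * T) * v := by
          gcongr
        have h3 : (2 * LT) ^ 5 / (2 * T) * v * T = 16 * v * LT ^ 5 := by
          field_simp
          ring
        calc Real.log v ^ 5 * T ≤ (2 * LT) ^ 5 / (2 * T) * v * T :=
              mul_le_mul_of_nonneg_right (h1.trans h2) hT0.le
          _ = 16 * v * LT ^ 5 := h3
      have hb : v * calL χ v * Real.log v ^ (4 : ℕ) ≤ 16 * v ^ 2 * cLT * LT ^ 4 / T := by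
        rw [le_div_iff₀ hT0]
        have h1 : v * calL χ v * Real.log v ^ (4 : ℕ) * T * LT ≤ 16 * v ^ 2 * cLT * LT ^ 4 * LT := by
          calc v * calL χ v * Real.log v ^ (4 : ℕ) * T * LT
              = v * (calL χ v * LT) * Real.log v ^ (4 : ℕ) * T := by ring
            _ ≤ v * (cLT * Real.log v) * Real.log v ^ (4 : ℕ) * T :=
                mul_le_mul_of_nonneg_right (mul_le_mul_of_nonneg_right
                  (mul_le_mul_of_nonneg_left hcal hv0.le) (by positivity)) hT0.le
            _ = v * cLT * (Real.log v ^ 5 * T) := by ring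
            _ ≤ v * cLT * (16 * v * LT ^ 5) :=
                mul_le_mul_of_nonneg_left hlv5 (mul_nonneg hv0.le hcLT0)
            _ = 16 * v ^ 2 * cLT * LT ^ 4 * LT := by ring
        exact le_of_mul_le_mul_right h1 hLT0
      have ha : v * ℓ ^ (7 : ℕ) ≤ v ^ 2 * ℓ ^ (7 : ℕ) / T := by
        rw [le_div_iff₀ hT0]
        have hℓ7 : 0 ≤ ℓ ^ (7 : ℕ) := by positivity
        linarith [mul_nonneg (mul_nonneg hv0.le hℓ7) (sub_nonneg.2 hvT)]
      have hXv : v * ℓ ^ (7 : ℕ) + v * calL χ v * Real.log v ^ (4 : ℕ) ≤ 16 * X * (v ^ 2 / T ^ 2) := by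
        have e : 16 * X * (v ^ 2 / T ^ 2) =
            16 * (v ^ 2 * ℓ ^ (7 : ℕ) / T) + 16 * v ^ 2 * cLT * LT ^ 4 / T := by
          rw [hX]
          field_simp
        rw [e]
        have h0 : 0 ≤ v ^ 2 * ℓ ^ (7 : ℕ) / T := by positivity
        linarith
      refine hfinal (16 * Cp) (by linarith [sq_nonneg M, hCA.le, hCp.le]) ?_
      calc ‖classGroupLFunction K ψ (1 / 2 + u * I)‖ ^ 2
          ≤ Cp * (v * ℓ ^ (7 : ℕ) + v * calL χ v * Real.log v ^ (4 : ℕ)) := hLu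
        _ ≤ Cp * (16 * X * (v ^ 2 / T ^ 2)) := mul_le_mul_of_nonneg_left hXv hCp.le
        _ ≤ Cp * (16 * X * r) := by gcongr
        _ = 16 * Cp * X * r := by ring
  · push Not at hlarge
    by_cases hsmall : |u| < q + 5
    · -- the uniform convexity bound
      have hcr := norm_le_crude K h2 hdisc ψ u
      have hu3 : |u| + 3 ≤ 3 * q := by linarith
      have hL1 : ‖classGroupLFunction K ψ (1 / 2 + u * I)‖ ≤ 2970 * (q : ℝ) ^ (4 : ℕ) := by
        calc ‖classGroupLFunction K ψ (1 / 2 + u * I)‖ ≤ 2 * q * Real.exp 4 * (|u| + 3) ^ 3 := hcr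
          _ ≤ 2 * q * 55 * (3 * q) ^ 3 :=
              mul_le_mul (mul_le_mul_of_nonneg_left he4.le (by positivity))
                (pow_le_pow_left₀ (by positivity) hu3 3) (by positivity) (by positivity)
          _ = 2970 * (q : ℝ) ^ (4 : ℕ) := by ring
      have h60 : (8820900 : ℝ) ≤ (q : ℝ) ^ (60 : ℕ) := by
        have : (5 : ℝ) ^ (60 : ℕ) ≤ (q : ℝ) ^ (60 : ℕ) := pow_le_pow_left₀ (by norm_num) hq5 60
        exact le_trans (by norm_num) this
      have hL2 : ‖classGroupLFunction K ψ (1 / 2 + u * I)‖ ^ 2 ≤ X := by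
        have h0 : 0 ≤ ‖classGroupLFunction K ψ (1 / 2 + u * I)‖ := norm_nonneg _
        have hq8 : 0 ≤ (q : ℝ) ^ (8 : ℕ) := by positivity
        calc ‖classGroupLFunction K ψ (1 / 2 + u * I)‖ ^ 2 ≤ (2970 * (q : ℝ) ^ (4 : ℕ)) ^ 2 :=
              pow_le_pow_left₀ h0 hL1 2
          _ = 8820900 * (q : ℝ) ^ (8 : ℕ) := by ring
          _ ≤ (q : ℝ) ^ (60 : ℕ) * (q : ℝ) ^ (8 : ℕ) := mul_le_mul_of_nonneg_right h60 hq8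
          _ = (q : ℝ) ^ (68 : ℕ) := by ring
          _ ≤ T := by linarith
          _ ≤ X := hTX
      refine hfinal 16 (by linarith [sq_nonneg M, hCp.le, hCA.le]) ?_
      calc ‖classGroupLFunction K ψ (1 / 2 + u * I)‖ ^ 2 ≤ X := hL2
        _ = X * 1 := (mul_one _).symm
        _ ≤ X * (16 * r) := mul_le_mul_of_nonneg_left hr16 hX0
        _ = 16 * X * r := by ring
    · -- the approximate functional equation and Cauchy
      push Not at hsmall
      have hu1 : 1 ≤ |u| := by linarith
      have hu4 : 4 ≤ |u| := by linarith
      have huq : (q : ℝ) + 1 ≤ |u| := by linarith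
      have hAu := hA q hq χ hprim hquad hoddχ K h2 hdisc ψ u hu1
      have hRu := hR q hq0 K h2 hdisc ψ u huq hu4
      have hLu := norm_classGroupLFunction_le_afe hq0 K h2 hdisc ψ u
      set w : ℂ := 1 / 2 + u * I with hw
      set Y₂ : ℝ := condQ q * ‖w‖ + 2 with hY₂
      -- `Y₂ ≤ T/(3q)`
      have hQ0 : 0 < condQ q := condQ_pos hq0
      have hQ : condQ q ≤ q / 12 := condQ_le_div_twelve (by linarith)
      have hwn : ‖w‖ ≤ |u| + 1 := by
        calc ‖w‖ ≤ ‖(1 / 2 : ℂ)‖ + ‖(u : ℂ) * I‖ := norm_add_le _ _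
          _ = 1 / 2 + |u| := by
              rw [norm_mul, Complex.norm_I, mul_one, Complex.norm_real, Real.norm_eq_abs]
              norm_num
          _ ≤ |u| + 1 := by linarith
      have hY₂le : Y₂ ≤ T / (3 * q) := by
        have h1 : condQ q * ‖w‖ ≤ (q / 12) * (T / (q : ℝ) ^ (2 : ℕ) + 1) :=
          mul_le_mul hQ (hwn.trans (by linarith)) (norm_nonneg _) (by positivity)
        have h2 := height_le_div hq5 hT
        rw [hY₂]
        linarith
      have hY₂2 : 2 ≤ Y₂ := by
        have : 0 ≤ condQ q * ‖w‖ := by positivity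
        rw [hY₂]; linarith
      have hY₂pos : 0 < Y₂ := by linarith
      have hlog3 : 1 ≤ Real.log 3 := by
        rw [Real.le_log_iff_exp_le (by norm_num)]
        exact Real.exp_one_lt_d9.le.trans (by norm_num)
      have hlogY₂ : Real.log Y₂ ≤ LT - 1 - ℓ := by
        calc Real.log Y₂ ≤ Real.log (T / (3 * q)) := Real.log_le_log hY₂pos hY₂le
          _ = LT - (Real.log 3 + ℓ) := by
              rw [Real.log_div hTne (by positivity), Real.log_mul (by norm_num) hqpos.ne', hLT, hℓ]
          _ ≤ LT - 1 - ℓ := by linarith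
      have hlogY₂0 : 0 ≤ Real.log Y₂ := Real.log_nonneg (by linarith)
      have h1l : 1 + Real.log Y₂ ≤ LT := by linarith
      have h1l0 : 0 ≤ 1 + Real.log Y₂ := by linarith
      have h3l : 3 + Real.log Y₂ ≤ 2 * LT := by linarith
      have hY₂T : Y₂ ≤ T / q := by
        refine hY₂le.trans ?_
        exact div_le_div_of_nonneg_left hT0.le hqpos (by linarith)
      -- `|A|² ≤ 2 C_A X`
      have hA2 : ‖afeA K ψ q w‖ ^ 2 ≤ 2 * CA * X := by
        have s1 : (1 + Real.log Y₂) ^ 4 ≤ LT ^ 4 := pow_le_pow_left₀ h1l0 h1l 4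
        have h3l0 : 0 ≤ 3 + Real.log Y₂ := by linarith
        calc ‖afeA K ψ q w‖ ^ 2 ≤ CA * Y₂ * (1 + Real.log Y₂) ^ 4 * (3 + Real.log Y₂) := hAu
          _ ≤ CA * (T / q) * LT ^ 4 * (2 * LT) :=
              mul_le_mul (mul_le_mul (mul_le_mul_of_nonneg_left hY₂T hCA.le) s1
                (by positivity) (by positivity)) h3l h3l0 (by positivity)
          _ = 2 * CA * (T * LT ^ (5 : ℕ) / q) := by ring
          _ ≤ 2 * CA * X := mul_le_mul_of_nonneg_left hLT5 (by positivity)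
      have hL0 : 0 ≤ ‖classGroupLFunction K ψ w‖ := norm_nonneg _
      have hLle : ‖classGroupLFunction K ψ w‖ ≤ 2 * ‖afeA K ψ q w‖ + M := by linarith
      refine hfinal (256 * CA + 32 * M ^ 2) (by linarith [hCp.le]) ?_
      calc ‖classGroupLFunction K ψ w‖ ^ 2 ≤ (2 * ‖afeA K ψ q w‖ + M) ^ 2 :=
            pow_le_pow_left₀ hL0 hLle 2
        _ ≤ 8 * ‖afeA K ψ q w‖ ^ 2 + 2 * M ^ 2 := sq_two_mul_add_le _ _
        _ ≤ 8 * (2 * CA * X) + 2 * M ^ 2 * X := by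
            have hM2 : 0 ≤ 2 * M ^ 2 := by positivity
            linarith [mul_le_mul_of_nonneg_left hX1 hM2]
        _ = (16 * CA + 2 * M ^ 2) * X * 1 := by ring
        _ ≤ (16 * CA + 2 * M ^ 2) * X * (16 * r) :=
            mul_le_mul_of_nonneg_left hr16 (by positivity)
        _ = (256 * CA + 32 * M ^ 2) * X * r := by ring

/-! ### §3. Cauchy–Schwarz -/

/-- `Σ f g ≤ (Σ f²)^{1/2} (Σ g²)^{1/2}` (Cauchy–Schwarz, private plumbing). [folklore] -/
private theorem sum_mul_le_sqrt_mul_sqrt' {ι : Type*} (s : Finset ι) (f g : ι → ℝ) :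
    ∑ i ∈ s, f i * g i ≤ Real.sqrt (∑ i ∈ s, f i ^ 2) * Real.sqrt (∑ i ∈ s, g i ^ 2) := by
  rw [← Real.sqrt_mul (Finset.sum_nonneg fun i _ => sq_nonneg (f i))]
  exact (le_abs_self _).trans (Real.abs_le_sqrt (Finset.sum_mul_sq_le_sq_mul_sq s f g))

/-! ### §4. Proposition 9.1 for arbitrary companions, from Proposition 6.4 -/

/-- **CI PROPOSITION 9.1 (9.7) FOR ARBITRARY COMPANIONS, FROM PROPOSITION 6.4.** For `q` odd `> 4`,
`K = ℚ(√−q)`, `ψ ∈ Ĉℓ(K)`, a `1`-spaced `S ⊂ (T, 2T]` with `2q^68 ≤ T`, `2q²e^{(log q)²} ≤ T`, and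
ANY companion map `t′ : ℝ → ℝ` (as in the printed (8.4): "to each point `s_r` we associate a point
`s′_r`"): `E(T) = Σ_{t∈S}|ℓ(s)M̄(s) − x(s)| ≤ C·(T(log q)^6 + Tℒ(T)^{1/2}(log T)²(log q)^{5/2})` —
the conclusion VERBATIM that of the I6 binder `stub_prop91_large` / `prop91_close_of_proposition64`.
Companions within `T/4`: `prop91_far_of_proposition64`; remote companions: `norm_sq_le_remote`,
Cauchy and the mollifier mean square. [cite: ConreyIwaniec2002, Proposition 9.1 (9.7)] -/
theorem prop91_of_proposition64 (h64 : conreyIwaniec2002_proposition64) :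
    ∃ C : ℝ, 0 < C ∧
    ∀ (q : ℕ) [NeZero q], 4 < q → Odd q → ∀ χ : DirichletCharacter ℂ q,
      χ.IsPrimitive → χ.IsQuadratic → χ.Odd →
        ∀ (K : Type) [Field K] [NumberField K],
          Module.finrank ℚ K = 2 → NumberField.discr K = -(q : ℤ) →
            ∀ (ψ : ClassGroup (𝓞 K) →* ℂˣ) (T : ℝ) (S : Finset ℝ) (t' : ℝ → ℝ),
              2 * (q : ℝ) ^ (68 : ℕ) ≤ T → 2 * (q : ℝ) ^ (2 : ℕ) * Real.exp (Real.log q ^ (2 : ℕ)) ≤ T →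
                IsDyadicPointSet S T →
                defectE K ψ q S t' ≤
                  C * (T * Real.log q ^ (6 : ℕ) +
                    T * Real.sqrt (calL χ T) * Real.log T ^ (2 : ℕ) * Real.log q ^ ((5 : ℝ) / 2)) := by
  obtain ⟨CB, hCB, hB⟩ := prop91_far_of_proposition64 h64
  obtain ⟨CL, hCL, hL⟩ := sum_norm_classGroupLFunction_sq_le h64
  obtain ⟨C₂, hC₂, hM⟩ := sum_norm_shortInvSum_sq_le
  obtain ⟨Kc, hKc, hrem⟩ := norm_sq_le_remote h64
  refine ⟨CB + Real.sqrt (CL * C₂) + Real.sqrt (2 * Kc * C₂) + 1, by positivity,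
    fun q _ hq hodd χ hprim hquad hoddχ K _ _ h2 hdisc ψ T S t' hT hexpT hS => ?_⟩
  classical
  -- numerics
  have hq0 : 0 < q := by omega
  have hq5 : (5 : ℝ) ≤ q := by exact_mod_cast hq
  have hq1 : (1 : ℝ) ≤ q := by linarith
  have hqpos : (0 : ℝ) < q := by linarith
  have hexp0 := Real.exp_pos (Real.log q ^ (2 : ℕ))
  have hq6668 : (q : ℝ) ^ (66 : ℕ) ≤ (q : ℝ) ^ (68 : ℕ) := pow_le_pow_right₀ hq1 (by norm_num)
  have hq68 : 0 ≤ (q : ℝ) ^ (68 : ℕ) := by positivity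
  have hq66 : (q : ℝ) ^ (66 : ℕ) ≤ T := by linarith
  have h2q66 : 2 * (q : ℝ) ^ (66 : ℕ) ≤ T := by linarith
  have hq2one : (1 : ℝ) ≤ (q : ℝ) ^ (2 : ℕ) := one_le_pow₀ hq1
  have hexpq2 : Real.exp (Real.log q ^ (2 : ℕ)) ≤ (q : ℝ) ^ (2 : ℕ) * Real.exp (Real.log q ^ (2 : ℕ)) :=
    le_mul_of_one_le_left hexp0.le hq2one
  have hexp1 : Real.exp (Real.log q ^ (2 : ℕ)) ≤ T := by linarith
  have h2exp : 2 * Real.exp (Real.log q ^ (2 : ℕ)) ≤ T := by linarith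
  obtain ⟨hℓ1, hℓLT, hLT1, -, hq41, -, hT3, -⟩ := prop81_numerics hq hq66 hexp1
  have hT0 : 0 < T := by linarith
  have h625 : (5 : ℝ) ^ (4 : ℕ) ≤ (q : ℝ) ^ (4 : ℕ) := pow_le_pow_left₀ (by norm_num) hq5 4
  have hq4cast : ((q ^ 4 : ℕ) : ℝ) = (q : ℝ) ^ (4 : ℕ) := by push_cast; ring
  have hT4 : (626 : ℝ) ≤ T := by norm_num at h625; linarith
  have hq4T : (q : ℝ) ^ (4 : ℕ) ≤ T := by linarith
  have hT2 : (2 : ℝ) ≤ T := by linarith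
  set ℓ : ℝ := Real.log q with hℓ
  set LT : ℝ := Real.log T with hLT
  set cLT : ℝ := calL χ T with hcLT
  have hℓ0 : 0 ≤ ℓ := by linarith
  have hcLT0 : 0 ≤ cLT := calL_nonneg χ (by linarith)
  set X : ℝ := T * ℓ ^ (7 : ℕ) + T * cLT * LT ^ (4 : ℕ) with hX
  set Y : ℝ := T * ℓ ^ (6 : ℕ) + T * Real.sqrt cLT * LT ^ (2 : ℕ) * ℓ ^ ((5 : ℝ) / 2) with hY
  have hX0 : 0 ≤ X := by positivity
  have hY0 : 0 ≤ Y := by positivity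
  have hTY : T ≤ Y := by
    have h6 : (1 : ℝ) ≤ ℓ ^ (6 : ℕ) := one_le_pow₀ hℓ1
    have h8 : T ≤ T * ℓ ^ (6 : ℕ) := le_mul_of_one_le_right hT0.le h6
    have : 0 ≤ T * Real.sqrt cLT * LT ^ (2 : ℕ) * ℓ ^ ((5 : ℝ) / 2) := by positivity
    rw [hY]; linarith
  have hcard : (S.card : ℝ) ≤ 2 * T := (hS.isPointSet hT2).card_le' (by linarith)
  -- split `S` by the distance of the companion
  set Sm := S.filter (fun t => |t' t - t| ≤ T / 4) with hSm
  set Sr := S.filter (fun t => ¬ |t' t - t| ≤ T / 4) with hSr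
  have hsplit : defectE K ψ q S t' = defectE K ψ q Sm t' + defectE K ψ q Sr t' := by
    unfold defectE
    exact (Finset.sum_filter_add_sum_filter_not S _ _).symm
  have hSmS : Sm ⊆ S := Finset.filter_subset _ _
  have hSrS : Sr ⊆ S := Finset.filter_subset _ _
  have hremote : ∀ t ∈ Sr, T / 4 < |t' t - t| := fun t ht => not_le.mp (Finset.mem_filter.1 ht).2
  -- (1) companions within `T/4`
  have hEm : defectE K ψ q Sm t' ≤ CB * Y :=
    hB q hq hodd χ hprim hquad hoddχ K h2 hdisc ψ T Sm t' h2q66 h2exp (hS.subset hSmS)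
      (fun t ht => (Finset.mem_filter.1 ht).2)
  -- (2) remote companions, pointwise
  set Lf : ℝ → ℂ := fun v => classGroupLFunction K ψ (1 / 2 + v * I) with hLf
  set Mf : ℝ → ℂ := fun v => shortInvSum K ψ q (1 / 2 + v * I) with hMf
  have hptw : ∀ t ∈ Sr,
      ‖dividedDifference (classGroupLFunction K ψ) (1 / 2 + t * I) (1 / 2 + t' t * I) *
            starRingEnd ℂ (shortInvSum K ψ q (1 / 2 + t * I)) -
          xQuot q (1 / 2 + t * I) (1 / 2 + t' t * I)‖ ≤
        4 / T * (‖Lf t‖ * ‖Mf t‖) + ‖Lf (t' t)‖ / |t' t - t| * ‖Mf t‖ + 8 / T := by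
    intro t ht
    have hd := hremote t ht
    have hne : t' t ≠ t := by
      intro e; rw [e, sub_self, abs_zero] at hd; linarith
    have hd0 : 0 < |t' t - t| := by linarith
    have hinv : 1 / |t' t - t| ≤ 4 / T := by
      rw [div_le_div_iff₀ hd0 hT0]; linarith
    have hℓ' := norm_dividedDifference_half_le (classGroupLFunction K ψ) hne
    have hx := norm_xQuot_le_two_div hq0 hne
    have hM0 : 0 ≤ ‖Mf t‖ := norm_nonneg _
    have hL0 : 0 ≤ ‖Lf t‖ := norm_nonneg _
    have hL0' : 0 ≤ ‖Lf (t' t)‖ := norm_nonneg _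
    calc ‖dividedDifference (classGroupLFunction K ψ) (1 / 2 + t * I) (1 / 2 + t' t * I) *
              starRingEnd ℂ (Mf t) - xQuot q (1 / 2 + t * I) (1 / 2 + t' t * I)‖
        ≤ ‖dividedDifference (classGroupLFunction K ψ) (1 / 2 + t * I) (1 / 2 + t' t * I) *
              starRingEnd ℂ (Mf t)‖ + ‖xQuot q (1 / 2 + t * I) (1 / 2 + t' t * I)‖ := norm_sub_le _ _
      _ = ‖dividedDifference (classGroupLFunction K ψ) (1 / 2 + t * I) (1 / 2 + t' t * I)‖ * ‖Mf t‖ +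
            ‖xQuot q (1 / 2 + t * I) (1 / 2 + t' t * I)‖ := by rw [norm_mul, RCLike.norm_conj]
      _ ≤ (‖Lf t‖ + ‖Lf (t' t)‖) / |t' t - t| * ‖Mf t‖ + 2 / |t' t - t| := by gcongr
      _ = (1 / |t' t - t|) * (‖Lf t‖ * ‖Mf t‖) + ‖Lf (t' t)‖ / |t' t - t| * ‖Mf t‖ +
            2 * (1 / |t' t - t|) := by ring
      _ ≤ 4 / T * (‖Lf t‖ * ‖Mf t‖) + ‖Lf (t' t)‖ / |t' t - t| * ‖Mf t‖ + 2 * (4 / T) := by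
          gcongr
      _ = 4 / T * (‖Lf t‖ * ‖Mf t‖) + ‖Lf (t' t)‖ / |t' t - t| * ‖Mf t‖ + 8 / T := by ring
  have hEr : defectE K ψ q Sr t' ≤
      ∑ t ∈ Sr, (4 / T * (‖Lf t‖ * ‖Mf t‖) + ‖Lf (t' t)‖ / |t' t - t| * ‖Mf t‖ + 8 / T) := by
    unfold defectE
    exact Finset.sum_le_sum hptw
  rw [Finset.sum_add_distrib, Finset.sum_add_distrib, Finset.sum_const, nsmul_eq_mul,
    ← Finset.mul_sum] at hEr
  -- the mean squares at hand
  have hD : ∑ t ∈ S, ‖Lf t‖ ^ 2 ≤ CL * (T * ℓ ^ (7 : ℕ) + T * cLT * LT ^ (4 : ℕ)) :=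
    hL q hq hodd χ hprim hquad hoddχ K h2 hdisc ψ T S hq66 hexp1 hS
  have hSM : ∑ t ∈ S, ‖Mf t‖ ^ 2 ≤ C₂ * (T * ℓ ^ (5 : ℕ)) :=
    hM q hq hodd χ hprim hquad hoddχ K h2 hdisc ψ T S hq4T hS
  have hSMr : ∑ t ∈ Sr, ‖Mf t‖ ^ 2 ≤ C₂ * (T * ℓ ^ (5 : ℕ)) :=
    (Finset.sum_le_sum_of_subset_of_nonneg hSrS fun _ _ _ => by positivity).trans hSM
  -- (2a) `(4/T) Σ |L(s)||M(s)| ≤ √(C_L C₂) Y`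
  have h2a : 4 / T * ∑ t ∈ Sr, ‖Lf t‖ * ‖Mf t‖ ≤ Real.sqrt (CL * C₂) * Y := by
    have h1 : ∑ t ∈ Sr, ‖Lf t‖ * ‖Mf t‖ ≤ Real.sqrt (CL * C₂) * Y := by
      calc ∑ t ∈ Sr, ‖Lf t‖ * ‖Mf t‖ ≤ ∑ t ∈ S, ‖Lf t‖ * ‖Mf t‖ :=
            Finset.sum_le_sum_of_subset_of_nonneg hSrS fun _ _ _ => by positivity
        _ ≤ Real.sqrt (∑ t ∈ S, ‖Lf t‖ ^ 2) * Real.sqrt (∑ t ∈ S, ‖Mf t‖ ^ 2) :=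
            sum_mul_le_sqrt_mul_sqrt' S _ _
        _ ≤ Real.sqrt (CL * C₂) * Y := diagonal_term_le hCL hC₂ hT0.le hℓ0 hcLT0 hD hSM
    have h4T : 4 / T ≤ 1 := by rw [div_le_one hT0]; linarith
    have h0 : 0 ≤ ∑ t ∈ Sr, ‖Lf t‖ * ‖Mf t‖ := Finset.sum_nonneg fun _ _ => by positivity
    have hsq0 : 0 ≤ Real.sqrt (CL * C₂) * Y := by positivity
    calc 4 / T * ∑ t ∈ Sr, ‖Lf t‖ * ‖Mf t‖ ≤ 1 * ∑ t ∈ Sr, ‖Lf t‖ * ‖Mf t‖ :=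
          mul_le_mul_of_nonneg_right h4T h0
      _ ≤ Real.sqrt (CL * C₂) * Y := by rw [one_mul]; exact h1
  -- (2b) the remote companions through the pointwise bound
  have hG : ∑ t ∈ Sr, (‖Lf (t' t)‖ / |t' t - t|) ^ 2 ≤
      2 * Kc / T * (T * ℓ ^ (7 : ℕ) + T * cLT * LT ^ (4 : ℕ)) := by
    have hpt : ∀ t ∈ Sr, (‖Lf (t' t)‖ / |t' t - t|) ^ 2 ≤ Kc * X / T ^ 2 := by
      intro t ht
      have hd := hremote t ht
      have htS := hS.mem_bounds (hSrS ht)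
      have h := hrem q hq hodd χ hprim hquad hoddχ K h2 hdisc ψ T t (t' t) hT hexpT htS.1 htS.2 hd
      have hd0 : 0 < |t' t - t| := by linarith
      have hd2 : 0 < (t' t - t) ^ 2 := by rw [← sq_abs]; positivity
      rw [div_pow, sq_abs, div_le_iff₀ hd2]
      calc ‖Lf (t' t)‖ ^ 2 ≤ Kc * X * ((t' t - t) ^ 2 / T ^ 2) := h
        _ = Kc * X / T ^ 2 * (t' t - t) ^ 2 := by ring
    have hcardr : (Sr.card : ℝ) ≤ 2 * T := by
      have : (Sr.card : ℝ) ≤ S.card := by exact_mod_cast Finset.card_le_card hSrS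
      linarith
    have hKX : 0 ≤ Kc * X / T ^ 2 := by positivity
    calc ∑ t ∈ Sr, (‖Lf (t' t)‖ / |t' t - t|) ^ 2 ≤ ∑ t ∈ Sr, Kc * X / T ^ 2 := Finset.sum_le_sum hpt
      _ = Sr.card * (Kc * X / T ^ 2) := by rw [Finset.sum_const, nsmul_eq_mul]
      _ ≤ 2 * T * (Kc * X / T ^ 2) := mul_le_mul_of_nonneg_right hcardr hKX
      _ = 2 * Kc / T * X := by field_simp
      _ = 2 * Kc / T * (T * ℓ ^ (7 : ℕ) + T * cLT * LT ^ (4 : ℕ)) := by rw [hX]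
  have h2b : ∑ t ∈ Sr, ‖Lf (t' t)‖ / |t' t - t| * ‖Mf t‖ ≤ Real.sqrt (2 * Kc * C₂) * Y := by
    have hKT : 0 < 2 * Kc / T := by positivity
    calc ∑ t ∈ Sr, ‖Lf (t' t)‖ / |t' t - t| * ‖Mf t‖
        ≤ Real.sqrt (∑ t ∈ Sr, (‖Lf (t' t)‖ / |t' t - t|) ^ 2) * Real.sqrt (∑ t ∈ Sr, ‖Mf t‖ ^ 2) :=
          sum_mul_le_sqrt_mul_sqrt' Sr _ _
      _ ≤ Real.sqrt (2 * Kc / T * C₂) * Y := diagonal_term_le hKT hC₂ hT0.le hℓ0 hcLT0 hG hSMr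
      _ ≤ Real.sqrt (2 * Kc * C₂) * Y := by
          gcongr
          exact div_le_self (by positivity) (by linarith)
  -- (2c) the constant `8/T` per remote point
  have h2c : (Sr.card : ℝ) * (8 / T) ≤ Y := by
    have : (Sr.card : ℝ) ≤ S.card := by exact_mod_cast Finset.card_le_card hSrS
    have h16 : (Sr.card : ℝ) * (8 / T) ≤ 16 := by
      rw [mul_div_assoc', div_le_iff₀ hT0]; linarith
    linarith
  -- assemble
  have hErY : defectE K ψ q Sr t' ≤ (Real.sqrt (CL * C₂) + Real.sqrt (2 * Kc * C₂) + 1) * Y := by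
    have hexpand : (Real.sqrt (CL * C₂) + Real.sqrt (2 * Kc * C₂) + 1) * Y =
        Real.sqrt (CL * C₂) * Y + Real.sqrt (2 * Kc * C₂) * Y + Y := by ring
    rw [hexpand]
    linarith [hEr, h2a, h2b, h2c]
  have hcomb : (CB + Real.sqrt (CL * C₂) + Real.sqrt (2 * Kc * C₂) + 1) * Y =
      CB * Y + (Real.sqrt (CL * C₂) + Real.sqrt (2 * Kc * C₂) + 1) * Y := by ring
  rw [hsplit, hcomb]
  exact add_le_add hEm hErY

end ConreyIwaniec2002

end Literature.NumberTheory.LFunctions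

end
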